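import Mathlib
import Literature.Computability.AlgebraicComplexity.AlperBogartVelascoLowOrder
import Literature.Computability.AlgebraicComplexity.AlperBogartVelascoIsotropy
import Literature.Computability.AlgebraicComplexity.LandsbergRessayreNormalForm

/-!
# The Alper–Bogart–Velasco subspace for a determinant with vanishing `2`-jet

Route `ValiantsHypothesis/BorderApolarity`, crux `ToricWitnessObstructionQP`
(stmt-ValiantsHypothesis-14753), line `Sketch`, lead c5 — fifth helper for the regime analysis of
torus leading forms of `per₃` below Grenet's size `7` (crux work note `regimes.md`, §3 step (ii)):
the corank-`1` branch of the jet regime.  The tree's `exists_subspace_of_isAffineDetRepr_perPoly`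
(ABV Thm. 1.2 for `f = per_m`) uses the permanent only through (a) von zur Gathen's regularity
"`rank B(0) = n - 1`" and (b) the vanishing of the constant terms of `∂f` and `∂∂f`.  Here (a) is
taken as a hypothesis and (b) is stated for `f = det B` itself, so that the conclusion applies to
ANY affine matrix `B` whose determinant has vanishing linear and quadratic parts:

* `exists_subspace_of_det_lowOrder`: if `B` is an `n × n` matrix of affine polynomials in the
  variables `ι` over a field, `rank B(0) = n - 1`, and all `∂_a det B`, `∂_b ∂_a det B` have zero
  constant term, then there is a linear subspace `W` with `|ι| + 1 ≤ dim W + n` on which every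
  `∂_a det B` vanishes (ABV: the normal form `J + Z(x)`, `Z₁₁ = 0`, isotropy of `(Z_1j, Z_j1)`,
  `f ∈ I²`).

The proof is the tree's, with `perPoly` replaced by `det B` (adapted from
`Literature/Computability/AlgebraicComplexity/AlperBogartVelascoSubspace.lean`).
-/

noncomputable section

open Matrix MvPolynomial Finset Module

-- the mandated summit-side namespace repeats a component by design (single-problem summit)
set_option linter.dupNamespace false

namespace Summit.ValiantsHypothesis.ValiantsHypothesis.Theorems.BorderApolarityToricWitnessObstructionQP

namespace LowOrderSubspace

open Literature.Computability.AlgebraicComplexity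
open Literature.Computability.AlgebraicComplexity.AlperBogartVelasco LRPencil

/-- **ABV subspace for a determinant with vanishing `2`-jet.**  Let `B` be a square matrix of
affine polynomials (size `n ≥ 1`) over a field, with constant part of rank `n - 1`, and suppose the
constant terms of all `∂_a det B` and all `∂_b ∂_a det B` vanish.  Then there is a linear subspace
`W` of the variable space with `|ι| + 1 ≤ dim W + n` on which all `∂_a det B` vanish
(adapted from the tree's ABV Thm. 1.2 for the permanent). [cite: AlperBogartVelasco2017, Thm. 1.2] -/
theorem exists_subspace_of_det_lowOrder {K : Type*} [Field K] {ι : Type*} [Fintype ι]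
    [DecidableEq ι] {n : ℕ} (hn : 0 < n) {B : Matrix (Fin n) (Fin n) (MvPolynomial ι K)}
    (hdeg : ∀ r j, (B r j).totalDegree ≤ 1)
    (hrank : (constPart B).rank = n - 1)
    (hcc1 : ∀ a, constantCoeff (pderiv a B.det) = 0)
    (hcc2 : ∀ a b, constantCoeff (pderiv b (pderiv a B.det)) = 0) :
    ∃ W : Submodule K (ι → K), Fintype.card ι + 1 ≤ finrank K W + n ∧
      ∀ x ∈ W, ∀ a : ι, MvPolynomial.eval x (pderiv a B.det) = 0 := by
  classical
  have hrank' : (constPart B).rank = Fintype.card (Fin n) - 1 := by rw [Fintype.card_fin]; exact hrank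
  -- normal form `B' = V B U = J + Z(x)`, `J = Λ_{i₀}`
  obtain ⟨V, U, i₀, hV, hU, hVU⟩ :=
    exists_mul_mul_eq_lamMatrix (constPart B) hrank' (by rw [Fintype.card_fin]; exact hn)
  set B' : Matrix (Fin n) (Fin n) (MvPolynomial ι K) := V.map C * B * U.map C with hB'
  have hB0 : constPart B' = lamMatrix K i₀ := by
    rw [hB', constPart_mul, constPart_mul, constPart_map_C, constPart_map_C, hVU]
  have hB1 : ∀ r j, (B' r j).totalDegree ≤ 1 := by
    intro r j
    rw [hB', Matrix.mul_apply]
    refine totalDegree_finsetSum_le fun l _ => ?_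
    rw [Matrix.mul_apply, Matrix.map_apply]
    refine (totalDegree_mul _ _).trans ?_
    rw [totalDegree_C, add_zero]
    refine totalDegree_finsetSum_le fun k _ => ?_
    rw [Matrix.map_apply]
    refine (totalDegree_mul _ _).trans ?_
    rw [totalDegree_C, zero_add]
    exact hdeg k l
  -- `det B' = c · det B`, `c ≠ 0`
  set c : K := V.det * U.det with hc
  have hc0 : c ≠ 0 :=
    mul_ne_zero ((Matrix.isUnit_iff_isUnit_det V).1 hV).ne_zero
      ((Matrix.isUnit_iff_isUnit_det U).1 hU).ne_zero
  have hdetB : B'.det = C c * B.det := by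
    have hVd : (V.map (C : K →+* MvPolynomial ι K)).det = C V.det := by
      rw [← RingHom.mapMatrix_apply, ← RingHom.map_det]
    have hUd : (U.map (C : K →+* MvPolynomial ι K)).det = C U.det := by
      rw [← RingHom.mapMatrix_apply, ← RingHom.map_det]
    rw [hB', Matrix.det_mul, Matrix.det_mul, hVd, hUd, hc, map_mul]
    ring
  have hcc1' : ∀ a, constantCoeff (pderiv a B'.det) = 0 := fun a => by
    rw [hdetB, pderiv_C_mul, map_mul, constantCoeff_C, hcc1, mul_zero]
  have hcc2' : ∀ a b, constantCoeff (pderiv b (pderiv a B'.det)) = 0 := fun a b => by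
    rw [hdetB, pderiv_C_mul, pderiv_C_mul, map_mul, constantCoeff_C, hcc2, mul_zero]
  -- (ABV) `Z₁₁ = 0`
  have h00 : ∀ a, coeffMat B' a i₀ i₀ = 0 := by
    intro a
    rw [← constantCoeff_pderiv_det hB1 hB0 a, hcc1']
  -- (ABV) `Σ_j Z_{1j} Z_{j1} = 0`, polarised
  have hquad : ∀ a b, ∑ s, (coeffMat B' a i₀ s * coeffMat B' b s i₀ +
      coeffMat B' b i₀ s * coeffMat B' a s i₀) = 0 := by
    intro a b
    have h := constantCoeff_pderiv_pderiv_det hB1 hB0 h00 a b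
    rw [hcc2'] at h
    exact neg_eq_zero.1 h.symm
  -- ABV's linear map `G = (Z_{1j}, Z_{j1})_j` and `V(I) = ker G`
  let G : (ι → K) →ₗ[K] (Fin n → K) × (Fin n → K) :=
    { toFun := fun x => (fun j => ∑ w, x w * coeffMat B' w i₀ j, fun j => ∑ w, x w * coeffMat B' w j i₀)
      map_add' := fun x y => by
        ext j <;> simp [add_mul, Finset.sum_add_distrib]
      map_smul' := fun r x => by
        ext j <;> simp [Finset.mul_sum, mul_assoc] }
  have hN : ∀ (x : ι → K) (i j : Fin n),
      (∑ w, x w • coeffMat B' w) i j = ∑ w, x w * coeffMat B' w i j := by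
    intro x i j
    simp [Matrix.sum_apply]
  refine ⟨LinearMap.ker G, ?_, ?_⟩
  · -- `codim V(I) = dim im G ≤ n - 1`: `im G` is isotropic and lies in `w_{11} = 0`
    have hiso : ∀ z ∈ LinearMap.range G, ∀ z' ∈ LinearMap.range G,
        z.1 ⬝ᵥ z'.2 + z'.1 ⬝ᵥ z.2 = 0 := by
      rintro _ ⟨x, rfl⟩ _ ⟨x', rfl⟩
      have e1 : ∑ j, (∑ w, x w * coeffMat B' w i₀ j) * (∑ w', x' w' * coeffMat B' w' j i₀) =
          ∑ w, ∑ w', x w * x' w' * ∑ j, coeffMat B' w i₀ j * coeffMat B' w' j i₀ := by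
        calc ∑ j, (∑ w, x w * coeffMat B' w i₀ j) * (∑ w', x' w' * coeffMat B' w' j i₀)
            = ∑ j, ∑ w, ∑ w', (x w * coeffMat B' w i₀ j) * (x' w' * coeffMat B' w' j i₀) := by
              refine Finset.sum_congr rfl fun j _ => ?_
              rw [Finset.sum_mul_sum]
          _ = ∑ w, ∑ w', ∑ j, (x w * coeffMat B' w i₀ j) * (x' w' * coeffMat B' w' j i₀) := by
              rw [Finset.sum_comm]
              refine Finset.sum_congr rfl fun w _ => ?_
              rw [Finset.sum_comm]
          _ = ∑ w, ∑ w', x w * x' w' * ∑ j, coeffMat B' w i₀ j * coeffMat B' w' j i₀ := by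
              refine Finset.sum_congr rfl fun w _ => Finset.sum_congr rfl fun w' _ => ?_
              rw [Finset.mul_sum]
              refine Finset.sum_congr rfl fun j _ => ?_
              ring
      have e2 : ∑ j, (∑ w', x' w' * coeffMat B' w' i₀ j) * (∑ w, x w * coeffMat B' w j i₀) =
          ∑ w, ∑ w', x w * x' w' * ∑ j, coeffMat B' w' i₀ j * coeffMat B' w j i₀ := by
        calc ∑ j, (∑ w', x' w' * coeffMat B' w' i₀ j) * (∑ w, x w * coeffMat B' w j i₀)
            = ∑ j, ∑ w', ∑ w, (x' w' * coeffMat B' w' i₀ j) * (x w * coeffMat B' w j i₀) := by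
              refine Finset.sum_congr rfl fun j _ => ?_
              rw [Finset.sum_mul_sum]
          _ = ∑ w', ∑ w, ∑ j, (x' w' * coeffMat B' w' i₀ j) * (x w * coeffMat B' w j i₀) := by
              rw [Finset.sum_comm]
              refine Finset.sum_congr rfl fun w' _ => ?_
              rw [Finset.sum_comm]
          _ = ∑ w, ∑ w', x w * x' w' * ∑ j, coeffMat B' w' i₀ j * coeffMat B' w j i₀ := by
              rw [Finset.sum_comm]
              refine Finset.sum_congr rfl fun w _ => Finset.sum_congr rfl fun w' _ => ?_
              rw [Finset.mul_sum]
              refine Finset.sum_congr rfl fun j _ => ?_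
              ring
      show (∑ j, (∑ w, x w * coeffMat B' w i₀ j) * (∑ w', x' w' * coeffMat B' w' j i₀)) +
        ∑ j, (∑ w', x' w' * coeffMat B' w' i₀ j) * (∑ w, x w * coeffMat B' w j i₀) = 0
      rw [e1, e2, ← Finset.sum_add_distrib]
      refine Finset.sum_eq_zero fun w _ => ?_
      rw [← Finset.sum_add_distrib]
      refine Finset.sum_eq_zero fun w' _ => ?_
      rw [← mul_add, ← Finset.sum_add_distrib, hquad w w', mul_zero]
    have h0' : ∀ z ∈ LinearMap.range G, z.1 i₀ = 0 ∧ z.2 i₀ = 0 := by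
      rintro _ ⟨x, rfl⟩
      refine ⟨?_, ?_⟩
      · show ∑ w, x w * coeffMat B' w i₀ i₀ = 0
        exact Finset.sum_eq_zero fun w _ => by rw [h00 w, mul_zero]
      · show ∑ w, x w * coeffMat B' w i₀ i₀ = 0
        exact Finset.sum_eq_zero fun w _ => by rw [h00 w, mul_zero]
    have hrange := finrank_add_one_le_card_of_isotropic (LinearMap.range G) i₀ hiso h0'
    have hrn := LinearMap.finrank_range_add_finrank_ker G
    rw [finrank_fintype_fun_eq_card] at hrn
    rw [Fintype.card_fin] at hrange
    omega
  · -- `V(I) ⊆ Sing`: all partials vanish on `ker G`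
    intro x hx a
    have hx' : G x = 0 := LinearMap.mem_ker.1 hx
    have hrow : ∀ j, (∑ w, x w • coeffMat B' w) i₀ j = 0 := fun j => by
      rw [hN]
      exact congr_fun (congr_arg Prod.fst hx') j
    have hcol : ∀ j, (∑ w, x w • coeffMat B' w) j i₀ = 0 := fun j => by
      rw [hN]
      exact congr_fun (congr_arg Prod.snd hx') j
    have h := eval_pderiv_det_eq_zero hB1 hB0 a (h00 a) x hrow hcol
    rw [hdetB, pderiv_C_mul, map_mul, eval_C] at h
    exact (mul_eq_zero.1 h).resolve_left hc0

end LowOrderSubspace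

/-- **ABV subspace for a determinant with vanishing `2`-jet** (registered helper form of
`LowOrderSubspace.exists_subspace_of_det_lowOrder`). [cite: AlperBogartVelasco2017, Thm. 1.2] -/
theorem lowOrderSubspace_of_det : ∀ {K : Type*} [Field K] {ι : Type*} [Fintype ι] [DecidableEq ι] {n : ℕ}, 0 < n → ∀ {B : Matrix (Fin n) (Fin n) (MvPolynomial ι K)}, (∀ r j, (B r j).totalDegree ≤ 1) → (Literature.Computability.AlgebraicComplexity.constPart B).rank = n - 1 → (∀ a, MvPolynomial.constantCoeff (MvPolynomial.pderiv a B.det) = 0) → (∀ a b, MvPolynomial.constantCoeff (MvPolynomial.pderiv b (MvPolynomial.pderiv a B.det)) = 0) → ∃ W : Submodule K (ι → K), Fintype.card ι + 1 ≤ Module.finrank K ↥W + n ∧ ∀ x ∈ W, ∀ a : ι, MvPolynomial.eval x (MvPolynomial.pderiv a B.det) = 0 :=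
  fun hn _ hdeg hrank hcc1 hcc2 => LowOrderSubspace.exists_subspace_of_det_lowOrder hn hdeg hrank hcc1 hcc2

end Summit.ValiantsHypothesis.ValiantsHypothesis.Theorems.BorderApolarityToricWitnessObstructionQP
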